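import Summits.QuantumFields.BalabanUV.Beta.AccretiveCombesThomasSandwichSite
import Summits.QuantumFields.BalabanUV.Beta.MultiscaleDecayRowSums

/-!
# `Summit.QuantumFields.BalabanUV.Beta.AccretiveCombesThomasSandwichSiteGrowth` — the cell-lattice profile hypothesis of
# K4's weighted-row-sum ENDs DISCHARGED from a cell-count GROWTH clause (beta-d4-p2's `sum_exp_neg_le_of_growth` BY NAME):
# level-free WRS of the `Q`-sandwich of the multi-region MODEL operator

HONEST FRAMING (page 1 of everything in this cell).  Discharging `FlowStep.BetaPertH` would make Bałaban's ultraviolet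
stability UNCONDITIONAL — a constructive-QFT result; it is NOT the continuum limit and NOT the Clay problem.  This module
discharges nothing of `BetaPertH`; [folklore] bookkeeping, kernel-checked (unit `b2b-balaban-beta-d4-p3`, road P3, gen 10;
the consumer corollary beta-d4-p2-g8 pointed to in journal l.19687 when landing (ii-c) `MultiscaleDecayRowSums` p232228).
HONEST DEPENDENCY: continuum YM on T⁴ ⇐ BetaPertH ∧ nine spine estimates (0/9 proved); BetaPertH ⇐ (D1) ∧ (D4) ∧ CAP+tail;
G-an2-4 gates asym, D1 and NE2/3/4.

WHY THIS FILE.  K4 `AccretiveCombesThomasSandwichSite` (p232018) ends in `wrs_sandwich_inv_siteFloor` ∕ `wrs_cellSandwich_levelOp`: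
`WRS κ′ D (sandwich A q) (N∕ν₀·e^{2κδ}·L)` GIVEN the lattice profile `Σ_{y′} e^{−(κ−κ′)D(y,y′)} ≤ L`.  For the multiscale cell lattice
that profile is not a volume-free triviality; beta-d4-p2's (ii-c) `MultiscaleDecayRowSums.sum_exp_neg_le_of_growth` derives it,
level-freely, from a cell-count GROWTH clause `#{y′ : D(y,y′) < m} ≤ N₀Λ^m` (the SHAPE of the second half of [B6] (2.1)–(2.2):
bounded degree of the cube-adjacency structure) and the rate condition `Λe^{−(κ−κ′)} < 1`, with `L = N₀Λ∕(1 − Λe^{−(κ−κ′)})`.  This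
file composes the two BY NAME: §1 `wrs_sandwich_inv_siteFloor_of_growth` (abstract, any non-negative `D`); §2
**`wrs_cellSandwich_levelOp_of_growth`** — the cell-lattice sandwich of `cmat levelOp` in the setting of `MultiscaleDecay.hc_levelOp`:
`WRS κ′ (d_n on cell corners) (sandwich (cmat levelOp) q) (Nq∕(μ₀S_max⁻²)·e^{4κd}·N₀Λ∕(1 − Λe^{−(κ−κ′)}))` — every constant from
`d, c, a, C, κ, κ′, N₀, Λ` and the top scale only; no level count, no volume.  NOTHING of K4 or of (ii-c) is restated.
WHAT IS NOT HERE: the growth clause itself for a concrete region geometry (DATA; print's (2.1)–(2.2)), Dirichlet holes, Bałaban's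
`Q` ∕ vector operators, print's sup-norm (3.42) (the ℓ² → ℓ^∞ device), NODE A's RowData junction (α) (row owner).

ABSOLUTE RULE.  Nothing printed is cited as a fact; (2.1)–(2.2) ∕ (2.16) are LOCATORS of shapes.  Row D4: the (2.16)-currency END
of the MODEL decay chain with its last MODEL hypothesis made a named DATA clause; class of (T3) ∕ NODE O.2 UNCHANGED (critical-path
width 0); D4 DISCHARGE NO DATE; NOT BetaPertH, NOT continuum, NOT Clay, NOT summit progress.
-/

open scoped BigOperators Matrix ComplexConjugate
open Finset Complex Matrix

namespace Summit.QuantumFields.BalabanUV.Beta.AccretiveCombesThomasSandwichSiteGrowth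

open Summit.QuantumFields.BalabanUV.Beta.AccretiveCombesThomas
open Summit.QuantumFields.BalabanUV.Beta.AccretiveCombesThomasSandwich (sandwich)
open Summit.QuantumFields.BalabanUV.Beta.AccretiveCombesThomasSandwichSite
open Summit.QuantumFields.BalabanUV.Beta.MultiscaleDecayRowSums (sum_exp_neg_le_of_growth)
open Literature.MathematicalPhysics.QuantumFieldTheory.Balaban1983to89.B5Prop11Lower (nsq)
open Literature.MathematicalPhysics.QuantumFieldTheory.Balaban1983to89.B13PerturbativeStep (WRS)

noncomputable section

/-! ## §1 Abstract: the site-weight WRS END with the lattice profile discharged by a growth clause -/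

section Abstract

variable {X : Type*} [Fintype X] [DecidableEq X] {Y : Type} [Fintype Y]

/-- **WRS of the sandwich (site weights, floor) under a GROWTH clause.**  As `wrs_sandwich_inv_siteFloor`, with the profile
hypothesis `Σ_{y′} e^{−(κ−κ′)D(y,y′)} ≤ L` REPLACED by: `D ≥ 0`, `#{y′ : D(y,y′) < m} ≤ N₀Λ^m` for every row `y` and level `m : ℕ`,
`κ′ ≤ κ`, `Λe^{−(κ−κ′)} < 1`; then `WRS κ′ D (sandwich A q) (N∕ν₀·e^{2κδ}·(N₀Λ∕(1 − Λe^{−(κ−κ′)})))` — beta-d4-p2's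
`sum_exp_neg_le_of_growth` BY NAME supplies `L`. [cite: Balaban1984PropagatorsII, (2.1)-(2.2) p.224] [folklore] -/
theorem wrs_sandwich_inv_siteFloor_of_growth (A : Matrix X X ℂ) (blk : X → Y) (D : Y → Y → ℝ) (hD : ∀ y y', 0 ≤ D y y')
    (ρ : Y → X → ℝ) (δ : ℝ) (hρ0 : ∀ y' x, blk x = y' → ρ y' x ≤ δ) (hρD : ∀ y y' x, blk x = y → D y y' - δ ≤ ρ y' x)
    (q : Y → X → ℂ) (hq : ∀ y x, blk x ≠ y → q y x = 0) {N : ℝ} (hN0 : 0 ≤ N) (hN : ∀ y, nsq (q y) ≤ N)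
    {κ κ' ν₀ : ℝ} {ν : Y → ℝ} (hκ : 0 ≤ κ) (hν0 : 0 < ν₀) (hfl : ∀ y, ν₀ ≤ ν y)
    (hc : ∀ y', ∀ z : X → ℂ, ∑ x, ν (blk x) * ‖z x‖ ^ 2 ≤ (conjForm A κ (ρ y') z).re)
    {N₀ Λ : ℝ} (hN₀ : 0 ≤ N₀) (hΛ : 0 ≤ Λ)
    (hcount : ∀ y (m : ℕ), ((univ.filter fun y' => D y y' < m).card : ℝ) ≤ N₀ * Λ ^ m)
    (hκ' : κ' ≤ κ) (hrate : Λ * Real.exp (-(κ - κ')) < 1) :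
    WRS κ' D (sandwich A q) (N / ν₀ * Real.exp (2 * κ * δ) * (N₀ * Λ / (1 - Λ * Real.exp (-(κ - κ'))))) :=
  wrs_sandwich_inv_siteFloor A blk D ρ δ hρ0 hρD q hq hN0 hN hκ hν0 hfl hc fun y =>
    sum_exp_neg_le_of_growth (fun y' => D y y') (fun y' => hD y y') hN₀ hΛ (hcount y) (sub_nonneg.mpr hκ') hrate

end Abstract

/-! ## §2 The instance: level-free WRS of the cell-lattice sandwich of `cmat levelOp` under a cell-count growth clause -/

section Instance

open Summit.QuantumFields.BalabanUV.Beta.BoxPoincare (Box)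
open Summit.QuantumFields.BalabanUV.Beta.MultiscaleCoerciveTorus
open Summit.QuantumFields.BalabanUV.Beta.MultiscaleDistance
open Summit.QuantumFields.BalabanUV.Beta.MultiscaleDecayBudget
open Summit.QuantumFields.BalabanUV.Beta.CovariantTowerMatrix (cmat)
open Literature.MathematicalPhysics.QuantumFieldTheory.Balaban1983to89
open Literature.MathematicalPhysics.QuantumFieldTheory.Balaban1983to89.B9Thm37GluePU (bsrc btgt)
open Literature.MathematicalPhysics.QuantumFieldTheory.Balaban1983to89.B9Thm37GlueTorusCov (tblk)
open Literature.MathematicalPhysics.QuantumFieldTheory.Balaban1983to89.B9Thm37GlueTorusCovLevels (levelOp)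
open B5TorusCover (UT Ctr ctrU)

variable {d : ℕ} {N : Fin d → ℕ} [∀ i, NeZero (N i)] [NeZero d] {Cp J K : Type} [Fintype Cp] [DecidableEq Cp] [Nonempty Cp]
  [Fintype J] [Fintype K] (S : J → ℕ) (hS : ∀ l, 1 ≤ S l) (hdivS : ∀ l i, S l ∣ N i) (lvl : K → J)
  (zc : (k : K) → Ctr N (S (lvl k)))

/-- **LEVEL-FREE WRS OF THE CELL-LATTICE SANDWICH OF THE MULTI-REGION MODEL OPERATOR.**  Setting of
`AccretiveCombesThomasSandwichSite.wrs_cellSandwich_levelOp` (= of `MultiscaleDecay.hc_levelOp`; test vectors `q_k` supported in cell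
`k` with `‖q_k‖² ≤ Nq`; `S_l ≤ S_max`), with its cell-lattice profile hypothesis DISCHARGED by a cell-count GROWTH clause on the corner
distances `D(k,k′) = d_n(t_k, t_{k′})`: `#{k′ : D(k,k′) < m} ≤ N₀Λ^m`, `κ′ ≤ κ`, `Λe^{−(κ−κ′)} < 1`.  Then
`WRS κ′ D (sandwich (cmat levelOp) q) (Nq∕(μ₀S_max⁻²)·e^{2κ·2d}·N₀Λ∕(1 − Λe^{−(κ−κ′)}))`, `μ₀ = C − 2d·c_max²κ² − a_max(e^{2dκ} − 1)` — the
(2.16) currency with constants from `d, c, a, C, κ, κ′, N₀, Λ, S_max` only.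
[cite: Balaban1988RG2Cluster, (2.16) p.16; Balaban1984PropagatorsII, (2.1)-(2.2) p.224] [folklore] -/
theorem wrs_cellSandwich_levelOp_of_growth
    (hdisj : ∀ k k' v v', cellPt S hS hdivS lvl zc k v = cellPt S hS hdivS lvl zc k' v' → k = k')
    (hcover : ∀ x : UT N, ∃ k, ∃ v : Box d (S (lvl k)), cellPt S hS hdivS lvl zc k v = x)
    (Rm : UT N × Fin d → Cp → Cp → ℝ) (hRm : ∀ b i j, ∑ k, Rm b k i * Rm b k j = if i = j then (1 : ℝ) else 0)
    (T : J → UT N → Cp → Cp → ℝ) (hT : ∀ l x i i', ∑ k, T l x k i * T l x k i' = if i = i' then (1 : ℝ) else 0)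
    (a : J → ℝ) (ha : ∀ j, 0 ≤ a j) (ω : J → UT N → ℝ)
    (hsupp : ∀ l x, ω l (ctrU N (S l) (tblk (hS l) (hdivS l) x)) ≠ 0 → ∃ k v, lvl k = l ∧ cellPt S hS hdivS lvl zc k v = x)
    {amax : ℝ} (hamax : 0 ≤ amax)
    (hscale : ∀ k, a (lvl k) * ω (lvl k) (ctrU N (S (lvl k)) (zc k)) ^ 2 * (S (lvl k) : ℝ) ^ d ≤ amax / (S (lvl k) : ℝ) ^ 2)
    (c : UT N × Fin d → ℝ) {cmax : ℝ} (hc : ∀ b, |c b| ≤ cmax) {C : ℝ}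
    (hcoer : ∀ f : UT N × Cp → ℝ,
      C * ∑ k, ((S (lvl k) : ℝ) ^ 2)⁻¹ * ∑ v : Box d (S (lvl k)), ∑ i, f (cellPt S hS hdivS lvl zc k v, i) ^ 2 ≤
        ∑ p, f p * levelOp bsrc btgt c Rm (fun l x => ctrU N (S l) (tblk (hS l) (hdivS l) x))
          (fun l x => ω l (ctrU N (S l) (tblk (hS l) (hdivS l) x))) T a f p)
    {κ : ℝ} (hκ0 : 0 ≤ κ) (hκ1 : κ ≤ 1) (hμ : 0 < C - 2 * d * cmax ^ 2 * κ ^ 2 - amax * (Real.exp (2 * d * κ) - 1))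
    {Smax : ℕ} (hSmax1 : 1 ≤ Smax) (hSmax : ∀ l, S l ≤ Smax)
    (q : K → UT N × Cp → ℂ) (hq : ∀ k p, cellOf S hS hdivS lvl zc hcover p.1 ≠ k → q k p = 0) {Nq : ℝ} (hNq0 : 0 ≤ Nq)
    (hNq : ∀ k, nsq (q k) ≤ Nq) {N₀ Λ : ℝ} (hN₀ : 0 ≤ N₀) (hΛ : 0 ≤ Λ)
    (hcount : ∀ k (m : ℕ), ((univ.filter fun k' => sdist bsrc btgt (siteScale S hS hdivS lvl zc hcover)
      (ctrU N (S (lvl k)) (zc k)) (ctrU N (S (lvl k')) (zc k')) < m).card : ℝ) ≤ N₀ * Λ ^ m)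
    {κ' : ℝ} (hκ' : κ' ≤ κ) (hrate : Λ * Real.exp (-(κ - κ')) < 1) :
    WRS κ' (fun k k' => sdist bsrc btgt (siteScale S hS hdivS lvl zc hcover) (ctrU N (S (lvl k)) (zc k))
        (ctrU N (S (lvl k')) (zc k')))
      (sandwich (cmat (levelOp bsrc btgt c Rm (fun l x => ctrU N (S l) (tblk (hS l) (hdivS l) x))
        (fun l x => ω l (ctrU N (S l) (tblk (hS l) (hdivS l) x))) T a)) q)
      (Nq / ((C - 2 * d * cmax ^ 2 * κ ^ 2 - amax * (Real.exp (2 * d * κ) - 1)) * ((Smax : ℝ) ^ 2)⁻¹) *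
        Real.exp (2 * κ * (2 * d)) * (N₀ * Λ / (1 - Λ * Real.exp (-(κ - κ'))))) :=
  wrs_cellSandwich_levelOp S hS hdivS lvl zc hdisj hcover Rm hRm T hT a ha ω hsupp hamax hscale c hc hcoer hκ0 hκ1 hμ hSmax1
    hSmax q hq hNq0 hNq fun k =>
      sum_exp_neg_le_of_growth
        (fun k' => sdist bsrc btgt (siteScale S hS hdivS lvl zc hcover) (ctrU N (S (lvl k)) (zc k)) (ctrU N (S (lvl k')) (zc k')))
        (fun _ => sdist_nonneg bsrc btgt _ _ _) hN₀ hΛ (hcount k) (sub_nonneg.mpr hκ') hrate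

end Instance

end

end Summit.QuantumFields.BalabanUV.Beta.AccretiveCombesThomasSandwichSiteGrowth
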